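import Literature.Computability.QuantumComplexity.RazTalBoundedDepth
import Literature.Computability.QuantumComplexity.ExactQuantumQuery
import Literature.Computability.Complexity.ACFourierTails
import Literature.Computability.QuantumComplexity.QueryHybridBound
import Literature.Computability.Complexity.CertificateAlgorithm
import Literature.Computability.QuantumComplexity.BlockSensitivityQuantumBound
import Literature.Computability.QuantumComplexity.SpectralAdversary
import Literature.Computability.Complexity.MidrijanisBound
import Literature.Computability.Complexity.HuangDegree
import Literature.Computability.QuantumComplexity.GroverSearch
import Literature.Computability.QuantumComplexity.GroverSearchLowerBound
import HarnessLib

/-!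
# Discharge of `raz_tal_forrelation` (quantum-advantage.S15) and of `Tal2017_fourierL1_ac0`

Topic `Literature/Computability/QuantumComplexity`; proofs for the named facts of file
`QueryComplexity` (`Literature.Computability.QuantumComplexity.raz_tal_forrelation`, Raz–Tal, *Oracle separation of BQP
and PH*, J. ACM 69 (2022), Thm. 1.1 in H21's form) and file `RazTalForrelation`
(`Tal2017_fourierL1_ac0`, Raz–Tal's Lemma 7.1 = Tal, CCC 2017, Thm. 37 / Cor. 4.8(3)).

The chain, all proved in the tree:

* `SwitchingLemma.lean` — Håstad's multi-switching lemma (Håstad 2014, Lemma 3.8);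
* `FourierTails.lean` — Tal 2017, §2–4 (LMN lemma, Lemmas 3.2/3.3, ESFT ⇒ L1);
* `ACFourierTails.lean` — Tal 2017, Thm. 3.6/3.8, Cor. 4.8(3) for circuits over `acBasis`
  (`Circuit.l1Level_acBasis_le`), whence `Tal2017_fourierL1_ac0_holds` below (the `L_{1,k}` of
  `RazTalForrelation`, `fourierL1Level`, is the `l1Level` of `FourierTails` at `χ ∘ f` by `rfl`);
* `RazTalForrelation.lean`, `RazTalBoundedDepth.lean` — Raz–Tal, §4–7 (the distribution `𝒟`,
  Cor. 6.4, Claims 7.2/7.3, Thm. 7.4, the assembly `raz_tal_forrelation_of_tal`).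

Also the discharge of **quantum-advantage.S09**, `Q₂(f) ≤ Q_E(f)`
(`quantumQueryComplexity_le_quantumQueryComplexity_zero_holds`; Buhrman–de Wolf, TCS 288
(2002), §3.3, p. 27: "`Q₂(f) ≤ Q_E(f) ≤ D(f) ≤ n` for all `f`"): error `0` is error `≤ 1/3`,
i.e. the monotonicity of `Q_ε(f)` in `ε` (`quantumQueryComplexity_anti`, discharged in
`ExactQuantumQuery.lean` from the `N`-query exact algorithm that makes the defining infimum
attained).

## Discharge of `detQueryComplexity_le_pow_six` (quantum-advantage.S12)

`detQueryComplexity_le_pow_six` (`∃ C, D(f) ≤ C · Q₂(f)⁶` for all total `f`;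
Beals–Buhrman–Cleve–Mosca–de Wolf, J. ACM 48 (2001), Thm. 5.4, `D(f) ≤ 4096 Q₂(f)⁶`;
Buhrman–de Wolf, TCS 288 (2002), Cor. 4, `D(f) ∈ O(Q₂(f)⁶)`) is proved as
`detQueryComplexity_le_pow_six_holds` with the constant `C = 144³ = 2985984`
(`detQueryComplexity_le_mul_quantumQueryComplexity_pow_six`), from the chain, all proved in the
tree:

* `PolynomialMethod.lean`, `ExactQuantumQuery.lean` — the model `QQueryAlg`, unitarity of the
  evolution, attainment of `Q_ε(f)` (Beals et al. §3–4);
* `QueryHybridBound.lean` — `bs(f) ≤ 144 T²` for a `T`-query algorithm with error `1/3`, hence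
  `bs(f) ≤ 144 Q₂(f)²` (`blockSensitivity_le_quantumQueryComplexity_sq`; Beals et al.
  Thm. 4.13, `Q₂(f) ≥ √(bs(f)/16)`, proved by the BBBV hybrid argument as the printed footnote
  allows, whence the weaker constant `144` instead of `16`; the printed `16` needs Markov's
  inequality for polynomials, absent from Mathlib);
* `BlockSensitivity.lean` — Nisan's `C⁽¹⁾(f) ≤ C(f) ≤ bs(f)²` (Beals et al. Lemma 5.2);
* `CertificateAlgorithm.lean` — `D(f) ≤ C⁽¹⁾(f) bs(f) ≤ bs(f)³` (Beals et al. Lemma 5.3).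

So `D(f) ≤ bs(f)³ ≤ (144 Q₂(f)²)³`; for `N = 0` both sides vanish (`D(f) ≤ N`). The printed
constant `4096 = 16³` (tree fact `Literature.Barriers.QuantumAdvantage.bealsEtAl2001_thm54`)
is NOT obtained here.

## Discharge of `detQueryComplexity_le_pow_four` (quantum-advantage.S12, ABKRT Thm. 1)

`detQueryComplexity_le_pow_four` (`∃ C, D(f) ≤ C · Q₂(f)⁴` for all total `f`;
Aaronson–Ben-David–Kothari–Rao–Tal, STOC 2021, Thm. 1, `D(f) = O(Q(f)⁴)`) is proved as
`detQueryComplexity_le_pow_four_holds` with `C = 16 · 144² = 331776`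
(`detQueryComplexity_le_mul_quantumQueryComplexity_pow_four`), assembled exactly as in their §1
("Proof of Theorem 1 assuming Theorem 2") from four results proved in the tree:

* `Complexity/MidrijanisBound.lean` — `D(f) ≤ bs(f) · deg(f)` (Midrijanis 2004, Thm. 4;
  `detQueryComplexity_le_blockSensitivity_mul_booleanDegree`, `deg = booleanDegree` of
  `Complexity/FourierDegree.lean`);
* `BlockSensitivityQuantumBound.lean` — `bs(f) ≤ 16 Q₂(f)²` (Beals et al. Thm. 4.13 with the
  printed constant, by the polynomial method, symmetrization and the tree's Markov / Ehlich–Zeller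
  inequalities `Literature/Analysis/Approximation/`);
* `Complexity/HuangDegree.lean` (`huang_degree_pointwise`, on `Complexity/HuangMatrix.lean`) —
  Huang 2019 in ABKRT's form `deg(f) ≤ λ(f)²`: a nonnegative unit `δ` with
  `√deg(f) · δ_x ≤ ∑_{i : f(x) ≠ f(x^i)} δ_{x^i}` for all `x`;
* `SpectralAdversary.lean` (`adversary_sum_le_quantumQueryComplexity`) — ABKRT Lemma 7 /
  spectral adversary: `∑_x ∑_{i : f(x) ≠ f(x^i)} δ_x δ_{x^i} ≤ 144 Q₂(f)`;

whence `deg(f) ≤ (144 Q₂(f))²` (`booleanDegree_le_sq_quantumQueryComplexity`, ABKRT Thm. 2 with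
an explicit constant) and `D(f) ≤ 16 Q₂(f)² · (144 Q₂(f))²`.

## Discharge of `grover_bbbv` (quantum-advantage.S11, `Q₂(OR_N) = Θ(√N)`)

`grover_bbbv` (`∃ 0 < c, C, ∀ N ≥ 1, c √N ≤ Q₂(OR_N) ≤ C √N`; Grover, STOC 1996;
Boyer–Brassard–Høyer–Tapp 1998; Bennett–Bernstein–Brassard–Vazirani 1997, Thm 3.5) is proved as
`grover_bbbv_holds` with `c = 1/4`, `C = 76`, from two files proved in the tree:

* `GroverSearchLowerBound.lean` — `√N ≤ 4 Q₂(OR_N)` (`sqrt_le_four_mul_quantumQueryComplexity_orFn`;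
  Beals et al. 2001, Thm 4.13 / §6, by the polynomial method: `PolynomialMethod.lean`,
  `Symmetrization.lean`, `Analysis/Approximation/EhlichZeller.lean`);
* `GroverSearch.lean` — `Q₂(OR_N) ≤ 76 √N` (`quantumQueryComplexity_orFn_le`): an explicit
  bounded-error algorithm in the model `QQueryAlg` (BBHT 1998: Grover's operators §6, the closed
  formula `sin²((2k+1)θ)` §3, Lemma 2 §4 for a uniformly random number `k < 2(⌊√N⌋+1)` of
  iterations realised coherently, then damping and nine rounds of amplitude amplification,
  Brassard–Høyer–Mosca–Tapp 2002 §2, in place of BBHT's adaptive repetition), built on the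
  straight-line query programs of `QueryPrograms.lean`.

## References

* R. Raz, A. Tal, *Oracle separation of BQP and PH*, J. ACM 69 (2022), Art. 30, Thm. 1.1,
  Lemma 7.1 [RazTalJACM2022].
* A. Tal, *Tight bounds on the Fourier spectrum of AC⁰*, CCC 2017 / ECCC TR14-174, Cor. 4.8 [Tal2017].
* H. Buhrman, R. de Wolf, *Complexity measures and decision tree complexity: a survey*,
  Theoret. Comput. Sci. 288 (2002) 21–43, §3.3, p. 27 (doi:10.1016/S0304-3975(01)00144-X)
  [Wolf2002] = [BuhrmanDewolf2002]; Thm. 11, Cor. 1 (p. 33–34), §5.3, Cor. 4 (p. 38).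
* R. Beals, H. Buhrman, R. Cleve, M. Mosca, R. de Wolf, *Quantum lower bounds by polynomials*,
  J. ACM 48 (2001) 778–797, Thm. 4.13, Lemmas 5.2–5.3, Thm. 5.4 (arXiv:quant-ph/9802049,
  pp. 9–11) [BealsEtAl2001].
* S. Aaronson, S. Ben-David, R. Kothari, S. Rao, A. Tal, *Degree vs. approximate degree and
  quantum implications of Huang's sensitivity theorem*, STOC 2021 (arXiv:2010.12629), §1 (proof of
  Thm. 1), Thm. 2, Lemma 7 [AaronsonBenDavidKothariRaoTal2021].
* G. Midrijanis, arXiv:quant-ph/0403168 (2004), Thm. 4 [Midrijanis2004]; H. Huang, Ann. of Math.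
  190 (2019), Thm. 1.1 [Huang2019].
* L. K. Grover, *A fast quantum mechanical algorithm for database search*, STOC 1996, 212–219
  [Grover1996]; M. Boyer, G. Brassard, P. Høyer, A. Tapp, *Tight bounds on quantum searching*,
  Fortschr. Phys. 46 (1998) 493–505 [BoyerEtAl1998]; G. Brassard, P. Høyer, M. Mosca, A. Tapp,
  *Quantum amplitude amplification and estimation*, Contemp. Math. 305 (2002) [BrassardEtAl2002];
  C. H. Bennett, E. Bernstein, G. Brassard, U. Vazirani, SIAM J. Comput. 26 (1997), Thm 3.5
  [BennettBernsteinBrassardVazirani1997] (for `grover_bbbv_holds`).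
-/

namespace Literature.Computability.QuantumComplexity

open Complexity Complexity.LowDegree Literature.Probability.RandomGraphs.LowDegree

/-- **Bridge**: the Boolean `L_{1,k}` of file `RazTalForrelation` is the real-valued `l1Level` of
file `FourierTails` at `χ ∘ f`. [folklore] -/
theorem fourierL1Level_eq_l1Level {m : ℕ} (f : (Fin m → Bool) → Bool) (k : ℕ) :
    fourierL1Level f k = l1Level (fun x => sgn (f x)) k := rfl

/-- **Tal's Fourier tail bound for AC⁰, discharged** (Raz–Tal, Lemma 7.1 = Tal 2017, Thm. 37 /
Cor. 4.8(3), in H21's circuit model, with the absolute constant `ACForm.talConst`): the named fact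
`Tal2017_fourierL1_ac0` holds. [cite: Tal2017, Corollary 4.8] [cite: RazTalJACM2022, Lemma 7.1] -/
theorem Tal2017_fourierL1_ac0_holds : Tal2017_fourierL1_ac0 :=
  ⟨ACForm.talConst, ACForm.talConst_pos, fun _m F _d _s hB hd hs h2 k => F.l1Level_acBasis_le hB hd hs h2 k⟩

/-- **quantum-advantage.S15 (Raz–Tal, Theorem 1.1 in H21's form), discharged**: the named fact
`raz_tal_forrelation` holds unconditionally — for each `n`, a distribution on `{0,1}^{2N}` on which a
one-query quantum algorithm has advantage `Ω(1/log N)` while every circuit of depth `d` and size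
`s` has advantage at most `(C log s)^{C(d+1)}/√N`. [cite: RazTalJACM2022, Thm. 1.1] -/
theorem raz_tal_forrelation_holds : raz_tal_forrelation :=
  raz_tal_forrelation_of_tal Tal2017_fourierL1_ac0_holds

/-- **quantum-advantage.S09 (`Q₂(f) ≤ Q_E(f)`), discharged** (Buhrman–de Wolf 2002, §3.3,
p. 27: "`Q₂(f) ≤ Q_E(f) ≤ D(f) ≤ n` for all `f`"): the named fact
`quantumQueryComplexity_le_quantumQueryComplexity_zero` holds — an exact algorithm is in
particular a bounded-error one, so `Q_{1/3}(f) ≤ Q_0(f)`; formally the case `0 ≤ 0 ≤ 1/3` of the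
monotonicity `quantumQueryComplexity_anti` of `Q_ε(f)` in `ε` (discharged as
`quantumQueryComplexity_anti_holds` in `ExactQuantumQuery.lean`, where the `N`-query exact
algorithm makes the infimum attained; for `N = 0` both sides are `0`).
[cite: Wolf2002, §3.3, p. 27] [cite: BuhrmanDewolf2002, §3.3, p. 27] -/
theorem quantumQueryComplexity_le_quantumQueryComplexity_zero_holds :
    ∀ {N : ℕ}, quantumQueryComplexity_le_quantumQueryComplexity_zero (N := N) := fun f =>
  Literature.Computability.Cryptography.quantumQueryComplexity_anti_holds le_rfl (by norm_num) f

/-! ### quantum-advantage.S12: `D(f) = O(Q₂(f)⁶)` (Beals et al. Thm. 5.4) -/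

open Cryptography in
/-- **Beals et al. Theorem 5.4, with the constant of the hybrid argument**: for every `N` and
every total `f : {0,1}ᴺ → {0,1}`, `D(f) ≤ 144³ · Q₂(f)⁶ = 2985984 · Q₂(f)⁶`
(`D(f) ≤ bs(f)³`, Lemmas 5.2–5.3, and `bs(f) ≤ 144 Q₂(f)²`; the printed constant is
`4096 = 16³`). For `N = 0` both sides are `0`. [cite: BealsEtAl2001, Thm 5.4] -/
theorem detQueryComplexity_le_mul_quantumQueryComplexity_pow_six (N : ℕ)
    (f : (Fin N → Bool) → Bool) :
    (detQueryComplexity f : ℝ) ≤ 2985984 * (quantumQueryComplexity (1 / 3) f : ℝ) ^ 6 := by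
  rcases Nat.eq_zero_or_pos N with rfl | hN
  · have h0 : detQueryComplexity f = 0 := Nat.eq_zero_of_le_zero (detQueryComplexity_le f)
    rw [h0, Nat.cast_zero]
    positivity
  · haveI : NeZero N := NeZero.of_pos hN
    have hD : (detQueryComplexity f : ℝ) ≤ (blockSensitivity f : ℝ) ^ 3 := by
      exact_mod_cast detQueryComplexity_le_blockSensitivity_pow_three f
    calc (detQueryComplexity f : ℝ) ≤ (blockSensitivity f : ℝ) ^ 3 := hD
      _ ≤ (144 * (quantumQueryComplexity (1 / 3) f : ℝ) ^ 2) ^ 3 :=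
          pow_le_pow_left₀ (Nat.cast_nonneg _) (blockSensitivity_le_quantumQueryComplexity_sq f) 3
      _ = 2985984 * (quantumQueryComplexity (1 / 3) f : ℝ) ^ 6 := by ring

open Cryptography in
/-- **quantum-advantage.S12 (Beals et al. Thm. 5.4 / Buhrman–de Wolf Cor. 4), discharged**: the
named fact `detQueryComplexity_le_pow_six` holds — deterministic and bounded-error quantum query
complexity of total Boolean functions are polynomially related, `D(f) ≤ C · Q₂(f)⁶` with
`C = 2985984`. [cite: BealsEtAl2001, Thm 5.4] [cite: BuhrmanDewolf2002, Corollary 4] -/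
theorem detQueryComplexity_le_pow_six_holds : detQueryComplexity_le_pow_six :=
  ⟨2985984, detQueryComplexity_le_mul_quantumQueryComplexity_pow_six⟩

/-! ### quantum-advantage.S12: `D(f) = O(Q₂(f)⁴)` (Aaronson–Ben-David–Kothari–Rao–Tal, Thm. 1) -/

section S12PowFour

open Cryptography SpectralAdversary

variable {N : ℕ}

/-- **Summing Huang's pointwise certificate against `δ`**: some nonnegative unit `δ` has
`√deg(f) ≤ ∑_x ∑_i Γ[x,x^i] δ_x δ_{x^i}` ("`λ(f) = ‖A_f‖ ≥ √n = √deg(f)`"), with the edge weights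
`edgeWeight` of `SpectralAdversary.lean` (bridge `flipBit i x = flipBlock x {i}`).
[cite: AaronsonBenDavidKothariRaoTal2021, Thm. "Huang" (§1, §3)] -/
theorem sqrt_booleanDegree_le_sum_edgeWeight (f : (Fin N → Bool) → Bool) :
    ∃ δ : (Fin N → Bool) → ℝ, (∀ x, 0 ≤ δ x) ∧ ∑ x, δ x ^ 2 = 1 ∧
      Real.sqrt (booleanDegree f) ≤ ∑ x, ∑ i, edgeWeight f δ x i := by
  obtain ⟨δ, hδ, hδ1, hpt⟩ := huang_degree_pointwise f
  refine ⟨δ, hδ, hδ1, ?_⟩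
  calc Real.sqrt (booleanDegree f) = ∑ x, δ x * (Real.sqrt (booleanDegree f) * δ x) := by
        have h : ∑ x, δ x * (Real.sqrt (booleanDegree f) * δ x) =
            Real.sqrt (booleanDegree f) * ∑ x, δ x ^ 2 := by
          rw [Finset.mul_sum]; exact Finset.sum_congr rfl fun x _ => by ring
        rw [h, hδ1, mul_one]
    _ ≤ ∑ x, δ x * ∑ i, (if f x = f (flipBlock x {i}) then 0 else δ (flipBlock x {i})) :=
        Finset.sum_le_sum fun x _ => mul_le_mul_of_nonneg_left (hpt x) (hδ x)
    _ = ∑ x, ∑ i, edgeWeight f δ x i := by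
        refine Finset.sum_congr rfl fun x _ => ?_
        rw [Finset.mul_sum]
        refine Finset.sum_congr rfl fun i _ => ?_
        rw [edgeWeight, flipBit_eq_flipBlock_singleton]
        split_ifs <;> simp

/-- **Aaronson–Ben-David–Kothari–Rao–Tal, Theorem 2** (with an explicit constant):
`deg(f) ≤ (144 · Q₂(f))²` for every total Boolean function — Huang's `deg(f) ≤ λ(f)²` combined
with the adversary bound `λ(f) ≤ 144 Q₂(f)`. [cite: AaronsonBenDavidKothariRaoTal2021, Thm. 2] -/
theorem booleanDegree_le_sq_quantumQueryComplexity (f : (Fin N → Bool) → Bool) :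
    (booleanDegree f : ℝ) ≤ (144 * (quantumQueryComplexity (1 / 3) f : ℝ)) ^ 2 := by
  obtain ⟨δ, hδ, hδ1, hsum⟩ := sqrt_booleanDegree_le_sum_edgeWeight f
  have h := hsum.trans (adversary_sum_le_quantumQueryComplexity f hδ hδ1)
  exact (Real.sqrt_le_left (by positivity)).mp h

/-- **Aaronson–Ben-David–Kothari–Rao–Tal, Theorem 1, with an explicit constant**: for every `N`
and every total `f : {0,1}ᴺ → {0,1}`, `D(f) ≤ 331776 · Q₂(f)⁴` (`= 16 · 144²`; the printed
statement is `D(f) = O(Q(f)⁴)`), from `D(f) ≤ bs(f) deg(f)`, `bs(f) ≤ 16 Q₂(f)²` and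
`deg(f) ≤ (144 Q₂(f))²`. [cite: AaronsonBenDavidKothariRaoTal2021, Thm. 1 (proof, §1)] -/
theorem detQueryComplexity_le_mul_quantumQueryComplexity_pow_four (N : ℕ)
    (f : (Fin N → Bool) → Bool) :
    (detQueryComplexity f : ℝ) ≤ 331776 * (quantumQueryComplexity (1 / 3) f : ℝ) ^ 4 := by
  have h1 : (detQueryComplexity f : ℝ) ≤ (blockSensitivity f : ℝ) * (booleanDegree f : ℝ) := by
    exact_mod_cast detQueryComplexity_le_blockSensitivity_mul_booleanDegree f
  have h2 := blockSensitivity_le_sixteen_mul_sq_real f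
  have h3 := booleanDegree_le_sq_quantumQueryComplexity f
  have hQ : (0 : ℝ) ≤ (quantumQueryComplexity (1 / 3) f : ℝ) := Nat.cast_nonneg _
  calc (detQueryComplexity f : ℝ) ≤ (blockSensitivity f : ℝ) * (booleanDegree f : ℝ) := h1
    _ ≤ (16 * (quantumQueryComplexity (1 / 3) f : ℝ) ^ 2) *
          (144 * (quantumQueryComplexity (1 / 3) f : ℝ)) ^ 2 :=
        mul_le_mul h2 h3 (Nat.cast_nonneg _) (by positivity)
    _ = 331776 * (quantumQueryComplexity (1 / 3) f : ℝ) ^ 4 := by ring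

/-- **quantum-advantage.S12 (Aaronson–Ben-David–Kothari–Rao–Tal, STOC 2021, Thm. 1), discharged**:
the named fact `detQueryComplexity_le_pow_four` holds — `D(f) ≤ C · Q₂(f)⁴` for all total
Boolean functions, with `C = 331776`. [cite: AaronsonBenDavidKothariRaoTal2021, Thm. 1] -/
theorem detQueryComplexity_le_pow_four_holds : detQueryComplexity_le_pow_four :=
  ⟨331776, detQueryComplexity_le_mul_quantumQueryComplexity_pow_four⟩

end S12PowFour

/-! ### quantum-advantage.S11: `Q₂(OR_N) = Θ(√N)` (Grover 1996; BBHT 1998; BBBV 1997) -/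

open Cryptography in
/-- **quantum-advantage.S11 (`grover_bbbv`), discharged**: `¼ √N ≤ Q₂(OR_N) ≤ 76 √N` for all
`N ≥ 1` — the lower bound by the polynomial method (`GroverSearchLowerBound.lean`, Beals et al.
2001, Thm 4.13 / §6; originally Bennett–Bernstein–Brassard–Vazirani 1997, Thm 3.5, and BBHT 1998,
§7), the upper bound by the bounded-error Grover search `Grover.searchAlg` of `GroverSearch.lean`
(Grover 1996; Boyer–Brassard–Høyer–Tapp 1998, §3–4, §6; amplitude amplification of
Brassard–Høyer–Mosca–Tapp 2002, §2). [cite: BoyerEtAl1998, §4 Thm 3 (upper bound) and §7 (lower bound)] -/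
theorem grover_bbbv_holds : grover_bbbv :=
  ⟨1 / 4, 76, by norm_num, fun N hN =>
    ⟨by have := sqrt_le_four_mul_quantumQueryComplexity_orFn hN; linarith,
      quantumQueryComplexity_orFn_le hN⟩⟩

end Literature.Computability.QuantumComplexity
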